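import Literature.NumberTheory.GaloisRepresentations.GlobalPFinitenessProofs
import Literature.NumberTheory.GaloisRepresentations.ContinuousH1
import Literature.NumberTheory.GaloisRepresentations.GlobalTriangulineSpace
import HarnessLib

/-!
# `H¹(G_{K,S}, M)` is finite for a finite `G_{K,S}`-module `M`

Topic `NumberTheory/GaloisRepresentations`; namespace `Literature.NumberTheory.GaloisRepresentations`.
THEOREMS ONLY (no definition, no named fact, no `sorry`). Width seat `bsd-line-sbc-p1-w2` (gen 7) of cell
`bsd-ssimc` (`--supports stmt-BirchSwinnertonDyer-20727`): the GLOBAL finite-coefficient input of the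
λ-dévissage in Greenberg, Doc. Math. 2006, Prop. 3.2 ("We will assume throughout that the cohomology groups
`Hⁱ(G, α_k)` are finite … This is so if (ii) `G = Gal(K_Σ/K)`", p. 358 L8–13) in degree `1`, for the named
fact `Literature.NumberTheory.IwasawaTheory.Greenberg2006.prop32_cohomology_isCofinitelyGenerated`.

Let `K` be a number field and `S` a FINITE set of finite places; `G_{K,S} = Γ_K ⧸ N_S`
(`GaloisGroupUnramifiedOutside K S`, `RestrictedRamification.lean`). The tree proves (Hermite's theorem)
that the open subgroups of `G_{K,S}` of index `≤ n` are finitely many for every `n`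
(`finite_setOf_isOpen_index_le_galoisGroupUnramifiedOutside`), whence Mazur's `Φ_p`
(`galoisGroupUnramifiedOutside_phiP_holds`) — which so far had no cohomological consumer. Here:

* §1 `finite_setOf_contAddHom_of_finite_setOf_isOpen_index_le` — in a compact group whose open subgroups of
  each bounded index are finitely many, an open subgroup `H` has only finitely many locally constant
  additive maps to ANY finite abelian group `M` (the tree's `mazurPhiP_of_finite_setOf_isOpen_index_le` with
  `ℤ/p` replaced by `M`: the kernel is an open subgroup of index `≤ [G:H]·|M|`).
* §2 for any topological group `G` and `X : TopRep R G`: a continuous crossed homomorphism is determined by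
  its restriction to a subgroup `U` and its values on representatives of `G ⧸ U`
  (`contOneCocycles.eq_of_restrict_eq_of_out_eq`); if `U` fixes `X` pointwise, `X` is finite discrete,
  `G ⧸ U` is finite and `U` has finitely many locally constant additive maps to `X`, then the continuous
  1-cocycles and `H¹(G, X) = continuousCohomology 1 X` are finite
  (`finite_contOneCocycles_of_finite_setOf_contAddHom`, `finite_continuousCohomology_one_of_finite_setOf_contAddHom`).
* §3 **`finite_H_one_unramifiedOutside`**: for `ρ : ContinuousRep (G_{K,S}) Λ M` with `M` finite and
  discrete, `Finite (ρ.H 1)` — `U` = the open stabiliser of `M` (`G_{K,S}` compact ⇒ finite index).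
  [NSW (8.3.20) (i) in degree one; Milne ADT I Cor. 4.15.]

No class field theory is used (degree `2` — (8.3.20) proper — is NOT treated).

References: [NeukirchSchmidtWingberg2008] J. Neukirch, A. Schmidt, K. Wingberg, *Cohomology of Number
Fields*, 2nd ed., (8.3.20) (i); [Greenberg2006] §3, p. 358 L8–13; [Mazur1989Deforming] §1.2 (`Φ_p` for
`G_{K,S}`); [SerreGaloisCohomology1997] I §5.1 (crossed homomorphisms).
-/

noncomputable section

open scoped NumberField Pointwise
open Field IsDedekindDomain Topology CategoryTheory TopRep ContinuousCohomology

namespace Literature.NumberTheory.GaloisRepresentations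

/-! ### §1. Finitely many locally constant additive maps to a finite abelian group -/

section ContAddHom

variable {G : Type*} [Group G] [TopologicalSpace G] [IsTopologicalGroup G] [CompactSpace G]

/-- **Finitely many locally constant additive maps from an open subgroup to a FINITE abelian group**, in a
compact group whose open subgroups of each bounded index are finitely many: the kernel of such an
`f : H → M` is an open subgroup of `G` of index `≤ [G:H]·|M|`, so `f` vanishes on the intersection `N₀`
of the finitely many open subgroups of that index, an open subgroup of finite index, and `f` is recovered
from `q ↦ f(q.out)` on the finite set `G ⧸ N₀`. (The tree's `mazurPhiP_of_finite_setOf_isOpen_index_le`,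
`ℤ/p` replaced by `M`.) [cite: Mazur1989Deforming, §1.1–§1.2] -/
theorem finite_setOf_contAddHom_of_finite_setOf_isOpen_index_le
    (hfin : ∀ n : ℕ, {V : Subgroup G | IsOpen (V : Set G) ∧ V.index ≤ n}.Finite)
    (M : Type*) [AddCommGroup M] [Finite M] (H : Subgroup G) (hH : IsOpen (H : Set G)) :
    {f : H → M | IsLocallyConstant f ∧ ∀ x y : H, f (x * y) = f x + f y}.Finite := by
  classical
  haveI : Finite (G ⧸ H) := Subgroup.quotient_finite_of_isOpen H hH
  haveI : H.FiniteIndex := Subgroup.finiteIndex_of_finite_quotient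
  have hMpos : 0 < Nat.card M := Nat.card_pos
  -- the finitely many open subgroups of index `≤ [G:H]·|M|` and their (open) intersection `N₀`
  set 𝒱 : Set (Subgroup G) := {V : Subgroup G | IsOpen (V : Set G) ∧ V.index ≤ H.index * Nat.card M}
    with h𝒱def
  have h𝒱 : 𝒱.Finite := hfin _
  set N₀ : Subgroup G := sInf 𝒱 with hN₀def
  have hN₀open : IsOpen (N₀ : Set G) := by
    rw [hN₀def, Subgroup.coe_sInf]
    exact h𝒱.isOpen_biInter fun V hV => hV.1
  haveI : Finite (G ⧸ N₀) := Subgroup.quotient_finite_of_isOpen N₀ hN₀open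
  have hN₀H : N₀ ≤ H := sInf_le ⟨hH, Nat.le_mul_of_pos_right _ hMpos⟩
  -- every locally constant additive `f : H → M` kills `N₀`
  have hvan : ∀ f : H → M, IsLocallyConstant f → (∀ x y : H, f (x * y) = f x + f y) →
      ∀ x : H, (x : G) ∈ N₀ → f x = 0 := by
    intro f hlc hadd x hx
    have f1 : f 1 = 0 := by
      have h := hadd 1 1
      rw [mul_one] at h
      exact add_eq_left.mp h.symm
    let φ : H →* Multiplicative M :=
      { toFun := fun x => Multiplicative.ofAdd (f x)
        map_one' := by simp [f1]
        map_mul' := fun x y => by simp [hadd, ofAdd_add] }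
    have hφ : ∀ x : H, φ x = Multiplicative.ofAdd (f x) := fun _ => rfl
    let V : Subgroup G := φ.ker.map H.subtype
    have hVopen : IsOpen (V : Set G) := by
      have hcoe : (V : Set G) = ((↑) : H → G) '' (φ.ker : Set H) := by
        rw [Subgroup.coe_map]
        rfl
      rw [hcoe]
      refine hH.isOpenMap_subtype_val _ ?_
      have hker : (φ.ker : Set H) = {x : H | f x = 0} := by
        ext x
        rw [SetLike.mem_coe, MonoidHom.mem_ker, hφ, Set.mem_setOf_eq, ofAdd_eq_one]
      rw [hker]
      exact hlc.isOpen_fiber 0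
    have hVindex : V.index ≤ H.index * Nat.card M := by
      rw [Subgroup.index_map_subtype, mul_comm]
      refine Nat.mul_le_mul_left _ ?_
      rw [Subgroup.index_ker]
      have hdvd : Nat.card φ.range ∣ Nat.card M := by
        have h := Subgroup.card_subgroup_dvd_card φ.range
        rwa [Nat.card_congr Multiplicative.toAdd] at h
      exact Nat.le_of_dvd hMpos hdvd
    have hN₀V : N₀ ≤ V := sInf_le ⟨hVopen, hVindex⟩
    obtain ⟨y, hy, hyx⟩ := Subgroup.mem_map.mp (hN₀V hx)
    have hyx' : y = x := Subtype.ext hyx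
    subst hyx'
    rw [MonoidHom.mem_ker, hφ, ofAdd_eq_one] at hy
    exact hy
  -- the injection `f ↦ (q ↦ f(q.out))` into the finite type `G ⧸ N₀ → M`
  let F : (H → M) → (G ⧸ N₀ → M) := fun f q =>
    if hq : q.out ∈ H then f ⟨q.out, hq⟩ else 0
  have key : ∀ f : H → M, IsLocallyConstant f → (∀ x y : H, f (x * y) = f x + f y) →
      ∀ h : H, F f (QuotientGroup.mk (h : G)) = f h := by
    intro f hlc hadd h
    obtain ⟨m, hm⟩ := QuotientGroup.mk_out_eq_mul N₀ (h : G)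
    have hmH : (m : G) ∈ H := hN₀H m.2
    have hout : (QuotientGroup.mk (h : G) : G ⧸ N₀).out ∈ H := by
      rw [hm]
      exact H.mul_mem h.2 hmH
    have hF : F f (QuotientGroup.mk (h : G)) = f ⟨_, hout⟩ := by
      simp only [F]
      rw [dif_pos hout]
    have heq : (⟨_, hout⟩ : H) = h * ⟨m, hmH⟩ := Subtype.ext hm
    rw [hF, heq, hadd, hvan f hlc hadd ⟨m, hmH⟩ m.2, add_zero]
  refine Set.Finite.of_finite_image (f := F) (Set.toFinite _) fun f hf f' hf' hff' => ?_
  funext h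
  rw [← key f hf.1 hf.2 h, ← key f' hf'.1 hf'.2 h, hff']

end ContAddHom

/-! ### §2. Continuous crossed homomorphisms: determined on a subgroup and a transversal -/

section Cocycles

universe uR v

variable {R : Type uR} [Ring R] [TopologicalSpace R]
  {G : Type v} [Group G] [TopologicalSpace G] [IsTopologicalGroup G] (X : TopRep.{v} R G)

omit [IsTopologicalGroup G] in
/-- **A continuous crossed homomorphism is determined by its restriction to a subgroup `U` and its values on
the representatives `q.out` of the left cosets `q ∈ G ⧸ U`**: `f(q.out · u) = f(q.out) + q.out · f(u)`.
[cite: SerreGaloisCohomology1997, I §5.1] -/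
theorem contOneCocycles.eq_of_restrict_eq_of_out_eq (U : Subgroup G) {f f' : contOneCocycles X}
    (hU : ∀ u : U, f.1 u = f'.1 u) (hout : ∀ q : G ⧸ U, f.1 q.out = f'.1 q.out) : f = f' := by
  apply Subtype.ext
  ext g
  obtain ⟨m, hm⟩ := QuotientGroup.mk_out_eq_mul U g
  have hg : g = (QuotientGroup.mk g : G ⧸ U).out * ((m⁻¹ : U) : G) := by
    rw [hm, mul_assoc, ← Subgroup.coe_mul, mul_inv_cancel, Subgroup.coe_one, mul_one]
  rw [hg, f.2, f'.2, hout, hU]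

omit [IsTopologicalGroup G] in
/-- If `U` fixes `X` pointwise, the restriction of a continuous crossed homomorphism to `U` is additive.
[cite: SerreGaloisCohomology1997, I §5.1] -/
theorem contOneCocycles.restrict_mul_of_forall_eq (U : Subgroup G)
    (htriv : ∀ u ∈ U, ∀ x : X, X.ρ u x = x) (f : contOneCocycles X) (a b : U) :
    f.1 ((a * b : U) : G) = f.1 a + f.1 b := by
  rw [Subgroup.coe_mul, f.2, htriv _ a.2]

omit [IsTopologicalGroup G] in
/-- **Finiteness of the continuous 1-cocycles.** If `X` is finite and discrete, `U ≤ G` has finite index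
(`G ⧸ U` finite), `U` fixes `X` pointwise and `U` admits only finitely many locally constant additive maps to
`X`, then `contOneCocycles X` is finite: `f ↦ (f|_U, q ↦ f(q.out))` is injective into a finite set.
[cite: NeukirchSchmidtWingberg2008, (8.3.20) (i) (degree one)] -/
theorem finite_contOneCocycles_of_finite_setOf_contAddHom [Finite X] [DiscreteTopology X]
    (U : Subgroup G) [Finite (G ⧸ U)] (htriv : ∀ u ∈ U, ∀ x : X, X.ρ u x = x)
    (hfin : {g : U → X | IsLocallyConstant g ∧ ∀ a b : U, g (a * b) = g a + g b}.Finite) :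
    Finite (contOneCocycles X) := by
  classical
  haveI := hfin.to_subtype
  let F : contOneCocycles X →
      {g : U → X | IsLocallyConstant g ∧ ∀ a b : U, g (a * b) = g a + g b} × (G ⧸ U → X) :=
    fun f ↦ (⟨fun u ↦ f.1 u,
        (IsLocallyConstant.iff_continuous _).2 (f.1.continuous.comp continuous_subtype_val),
        fun a b ↦ contOneCocycles.restrict_mul_of_forall_eq X U htriv f a b⟩,
      fun q ↦ f.1 q.out)
  refine Finite.of_injective F fun f f' h ↦ ?_
  have h1 := congrArg (fun z ↦ (z.1 : U → X)) h
  have h2 := congrArg Prod.snd h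
  exact contOneCocycles.eq_of_restrict_eq_of_out_eq X U (fun u ↦ congrFun h1 u) (fun q ↦ congrFun h2 q)

/-- **Finiteness of `H¹(G, X)`** under the same hypotheses (every class has a cocycle representative,
`oneCocycleClass_surjective`). [cite: NeukirchSchmidtWingberg2008, (8.3.20) (i) (degree one)] -/
theorem finite_continuousCohomology_one_of_finite_setOf_contAddHom [Finite X] [DiscreteTopology X]
    (U : Subgroup G) [Finite (G ⧸ U)] (htriv : ∀ u ∈ U, ∀ x : X, X.ρ u x = x)
    (hfin : {g : U → X | IsLocallyConstant g ∧ ∀ a b : U, g (a * b) = g a + g b}.Finite) :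
    Finite (continuousCohomology 1 X) := by
  haveI : Finite (contOneCocycles X) := finite_contOneCocycles_of_finite_setOf_contAddHom X U htriv hfin
  exact Finite.of_surjective (oneCocycleClass X) (oneCocycleClass_surjective X)

end Cocycles

/-! ### §3. `G_{K,S}`: `H¹(K_S/K, M)` is finite for finite `M` -/

section Global

universe u

variable {K : Type u} [Field K] [NumberField K] {S : Set (HeightOneSpectrum (𝓞 K))} (hS : S.Finite)
  {Λ : Type u} [CommRing Λ] [TopologicalSpace Λ]
  {M : Type u} [AddCommGroup M] [Module Λ M] [TopologicalSpace M] [DiscreteTopology M] [Finite M]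

include hS in
/-- **`H¹(K_S/K, M)` is finite** for a number field `K`, a FINITE set `S` of finite places and a FINITE
discrete `Λ`-module `M` with a continuous `Λ`-linear action of `G_{K,S} = Gal(K_S/K)` (the tree's
`ContinuousRep.H 1` = Mathlib's `continuousCohomology 1`). Proof: the stabiliser `U` of `M` is an open
subgroup of the compact group `G_{K,S}`, hence of finite index; it has finitely many locally constant additive
maps to `M` because the open subgroups of `G_{K,S}` of each bounded index are finitely many (Hermite,
`finite_setOf_isOpen_index_le_galoisGroupUnramifiedOutside`); conclude by §2. No class field theory.
[cite: NeukirchSchmidtWingberg2008, (8.3.20) (i) (degree one)] [cite: Mazur1989Deforming, §1.2] -/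
theorem finite_H_one_unramifiedOutside [ContinuousSMul Λ M]
    (ρ : ContinuousRep (GaloisGroupUnramifiedOutside K S) Λ M) : Finite (ρ.H 1) := by
  classical
  -- the stabiliser of `M`: an open subgroup of the compact group `G_{K,S}`
  let U : Subgroup (GaloisGroupUnramifiedOutside K S) :=
    { carrier := {g | ∀ m : M, ρ g m = m}
      one_mem' := fun m ↦ by simp
      mul_mem' := fun {a b} ha hb m ↦ by rw [map_mul, Module.End.mul_apply, hb m, ha m]
      inv_mem' := fun {a} ha m ↦ by
        have h := congrArg (ρ a⁻¹) (ha m)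
        rw [← Module.End.mul_apply, ← map_mul, inv_mul_cancel, map_one, Module.End.one_apply] at h
        exact h.symm }
  have hUmem : ∀ g, g ∈ U ↔ ∀ m : M, ρ g m = m := fun _ ↦ Iff.rfl
  have hUopen : IsOpen (U : Set (GaloisGroupUnramifiedOutside K S)) := by
    have hcoe : (U : Set (GaloisGroupUnramifiedOutside K S)) = ⋂ m : M, (fun g ↦ ρ g m) ⁻¹' {m} := by
      ext g
      simp only [SetLike.mem_coe, hUmem, Set.mem_iInter, Set.mem_preimage, Set.mem_singleton_iff]
    rw [hcoe]
    exact isOpen_iInter_of_finite fun m ↦ (isOpen_discrete {m}).preimage (ρ.continuous_apply_left m)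
  haveI : Finite (GaloisGroupUnramifiedOutside K S ⧸ U) := Subgroup.quotient_finite_of_isOpen U hUopen
  have hfin := finite_setOf_contAddHom_of_finite_setOf_isOpen_index_le
    (finite_setOf_isOpen_index_le_galoisGroupUnramifiedOutside K hS) M U hUopen
  have htriv : ∀ u ∈ U, ∀ x : (ρ.toTopRep : Type u), ρ.toTopRep.ρ u x = x := fun u hu x ↦ (hUmem u).1 hu x
  exact finite_continuousCohomology_one_of_finite_setOf_contAddHom ρ.toTopRep U htriv hfin

end Global

end Literature.NumberTheory.GaloisRepresentations

end
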